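import Summits.QuantumAdvantage.QuantumAdvantage.Theorems.CubicForrelationNearExactIsExactTwelveLevelSixH34RigidW

/-!
# Crux `CubicForrelation.NearExactIsExact` (stmt-QuantumAdvantage-14043) — n = 12, level ≥ 6 at `Φ = 933/1024`: (H3)/(H4) on the 9-flat for the
  RIGID configurations with up to TWO exceptional points (weighted few-hit transversals)

Certificate seat `b2b-cforr-cert` (gen 18).  HONEST FRAMING: a lemma (standard axioms) for the level-`≥ 6` branch of "is `933/1024` attained at
`n = 12`?" (budget `Σ e² ≤ 728`, off-flat energy `≤ 216`); finite-slice bookkeeping, NOT summit progress.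

Setting: cubic `f, g`, `W_g = 64u''`, `Z = {u'' even} = x_Z ⊕ V₀` (`#V₀ = 512`), `e = u'' − (−1)^f`.  At off-flat energy `≤ 216` the rigid
configurations have their points with `8 ∤ e` in a set `Ω` (`#Ω ≤ 61` is all we use; `≤ 54` holds) inside three cosets `yᵢ ⊕ V₀`, with
`e² = 4` on `Ω` EXCEPT possibly at two points `ω₄, ω₄'` (where `e = ±4`; the excess `24 = 12 + 12` of `tw18_rigid_pack216`).
`tw18_H34_rigid_w2` proves (H3) `4 ∣ Σ_{3-flat ⊂ Z} e` and (H4) `8 ∣ Σ_{4-flat ⊂ Z} e` exactly as `tw18_H34_rigid_w` (gen 18, one exceptional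
point): give `ω₄, ω₄'` weight `2` and the other points of `Ω` weight `1` (total `≤ 63`); by the weighted transversal lemma `tw18_dirs_few_hits_w`
the seven translates of an inner `k`-flat (`k ≤ 4`) can be chosen off `Z` with total weight `< 2` on them — so neither exceptional point is met
and at most one point of `Ω` is, where `e = ±2` (`tw18_family_mod8w`); the rest is gen 18's localisation argument verbatim.

References: J. Ax (1964) / R. J. McEliece (1972); MacWilliams–Sloane (1977) Ch. 13 §3.  Axioms: the standard three.
-/

set_option linter.dupNamespace false -- D-0017: single-problem summit ⇒ `QuantumAdvantage.QuantumAdvantage` by design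

noncomputable section

namespace Summit.QuantumAdvantage.QuantumAdvantage.Theorems.CubicForrelation.NearExactIsExact

open Finset
open Literature.Computability.QuantumComplexity
open Literature.Computability.QuantumComplexity.BuzetChailloux (bxor zeroVec bxor_bxor_cancel_left bxor_zeroVec zeroVec_bxor bxor_comm
  bxor_self)
open Literature.Computability.QuantumComplexity.DerivativeWalsh (W)

/-! ### (H3)/(H4) for the rigid configurations with up to two exceptional points -/

/-- **(H3) and (H4) on the 9-flat, rigid version with up to two exceptional points.**  Cubic `f, g`, `W_g = 64u''`, `Z = {u'' even} = x_Z ⊕ V₀`,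
`e = u'' − (−1)^f`; three cosets `yᵢ ⊕ V₀` (`yᵢ ∉ Z`, pairwise distinct) and a set `Ω` inside them with `#Ω ≤ 61`, such that off `Z` every point
with `8 ∤ e` lies in `Ω`, and `e² = 4` on `Ω` except possibly at the points `ω₄, ω₄'`.  Then every parametrised 3-flat sum of `e` inside `Z` is
`≡ 0 (mod 4)` and every 4-flat sum is `≡ 0 (mod 8)`. [this work] -/
theorem tw18_H34_rigid_w2 (f g : (Fin (6 + 6) → Bool) → Bool) (hf : IsDegLeFun 3 f) (hg : IsDegLeFun 3 g)
    (u'' : (Fin (6 + 6) → Bool) → ℤ) (hu'' : ∀ x, W (fun y => signOf (g y)) x = (2 : ℝ) ^ 6 * (u'' x : ℝ))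
    (V₀ : Finset (Fin (6 + 6) → Bool)) (xZ : Fin (6 + 6) → Bool) (h0 : zeroVec ∈ V₀)
    (hadd : ∀ a ∈ V₀, ∀ b ∈ V₀, bxor a b ∈ V₀) (hcardV : #V₀ = 512)
    (hS : (univ.filter fun x : Fin (6 + 6) → Bool => ¬ Odd (u'' x)) = V₀.image (bxor xZ))
    (Ω : Finset (Fin (6 + 6) → Bool)) (y₁ y₂ y₃ : Fin (6 + 6) → Bool)
    (hy₁ : y₁ ∉ (univ.filter fun x : Fin (6 + 6) → Bool => ¬ Odd (u'' x)))
    (hy₂ : y₂ ∉ (univ.filter fun x : Fin (6 + 6) → Bool => ¬ Odd (u'' x)))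
    (hy₃ : y₃ ∉ (univ.filter fun x : Fin (6 + 6) → Bool => ¬ Odd (u'' x)))
    (hy₁₂ : y₂ ∉ V₀.image (bxor y₁)) (hy₁₃ : y₃ ∉ V₀.image (bxor y₁)) (hy₂₃ : y₃ ∉ V₀.image (bxor y₂))
    (hΩC : ∀ ω ∈ Ω, ω ∈ V₀.image (bxor y₁) ∨ ω ∈ V₀.image (bxor y₂) ∨ ω ∈ V₀.image (bxor y₃)) (hΩ61 : #Ω ≤ 61)
    (hΩbad : ∀ y, y ∉ (univ.filter fun x : Fin (6 + 6) → Bool => ¬ Odd (u'' x)) → ¬ (8 : ℤ) ∣ u'' y - sZ (f y) → y ∈ Ω)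
    (ω₄ ω₄' : Fin (6 + 6) → Bool) (hΩsq : ∀ y ∈ Ω, (u'' y - sZ (f y)) ^ 2 = 4 ∨ y = ω₄ ∨ y = ω₄') :
    (∀ x ∈ (univ.filter fun x : Fin (6 + 6) → Bool => ¬ Odd (u'' x)), ∀ a b c : Fin (6 + 6) → Bool,
      a ∈ V₀ → b ∈ V₀ → c ∈ V₀ →
      (4 : ℤ) ∣ ∑ ε : Fin 3 → Bool, (u'' (fun j => x j ^^ decide (Odd #(univ.filter fun i =>
        ε i && (![a, b, c] : Fin 3 → Fin (6 + 6) → Bool) i j))) - sZ (f (fun j => x j ^^ decide (Odd #(univ.filter fun i =>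
        ε i && (![a, b, c] : Fin 3 → Fin (6 + 6) → Bool) i j)))))) ∧
    (∀ x ∈ (univ.filter fun x : Fin (6 + 6) → Bool => ¬ Odd (u'' x)), ∀ a₀ a₁ a₂ a₃ : Fin (6 + 6) → Bool,
      a₀ ∈ V₀ → a₁ ∈ V₀ → a₂ ∈ V₀ → a₃ ∈ V₀ →
      (8 : ℤ) ∣ ∑ ε : Fin 4 → Bool, (u'' (fun j => x j ^^ decide (Odd #(univ.filter fun i =>
        ε i && (![a₀, a₁, a₂, a₃] : Fin 4 → Fin (6 + 6) → Bool) i j))) - sZ (f (fun j => x j ^^ decide (Odd #(univ.filter fun i =>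
        ε i && (![a₀, a₁, a₂, a₃] : Fin 4 → Fin (6 + 6) → Bool) i j)))))) := by
  classical
  set Z := univ.filter (fun x : Fin (6 + 6) → Bool => ¬ Odd (u'' x)) with hZdef
  set e : (Fin (6 + 6) → Bool) → ℤ := fun x => u'' x - sZ (f x) with hedef
  show (∀ x ∈ Z, ∀ a b c : Fin (6 + 6) → Bool, a ∈ V₀ → b ∈ V₀ → c ∈ V₀ →
      (4 : ℤ) ∣ ∑ ε : Fin 3 → Bool, e (fun j => x j ^^ decide (Odd #(univ.filter fun i =>
        ε i && (![a, b, c] : Fin 3 → Fin (6 + 6) → Bool) i j)))) ∧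
    (∀ x ∈ Z, ∀ a₀ a₁ a₂ a₃ : Fin (6 + 6) → Bool, a₀ ∈ V₀ → a₁ ∈ V₀ → a₂ ∈ V₀ → a₃ ∈ V₀ →
      (8 : ℤ) ∣ ∑ ε : Fin 4 → Bool, e (fun j => x j ^^ decide (Odd #(univ.filter fun i =>
        ε i && (![a₀, a₁, a₂, a₃] : Fin 4 → Fin (6 + 6) → Bool) i j))))
  change ∀ y, y ∉ Z → ¬ (8 : ℤ) ∣ e y → y ∈ Ω at hΩbad
  change ∀ y ∈ Ω, e y ^ 2 = 4 ∨ y = ω₄ ∨ y = ω₄' at hΩsq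
  have hPV : ∀ x, x ∈ Z → ∀ a ∈ V₀, bxor x a ∈ Z := fun x hx a ha => fl1_coset_vadd hadd hS hx ha
  -- weights: `2` at the exceptional points, `1` elsewhere on `Ω`, total `≤ 63`
  set c : (Fin (6 + 6) → Bool) → ℕ := fun ω => if ω ∈ Ω then (if (ω = ω₄ ∨ ω = ω₄') then 2 else 1) else 0 with hcdef
  have hcΩ : ∀ ω, c ω ≠ 0 → ω ∈ V₀.image (bxor y₁) ∨ ω ∈ V₀.image (bxor y₂) ∨ ω ∈ V₀.image (bxor y₃) := by
    intro ω hω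
    by_cases h : ω ∈ Ω
    · exact hΩC ω h
    · exact absurd (by simp only [c, if_neg h]) hω
  have hcsum : ∑ ω, c ω ≤ 63 := by
    have h1 : ∑ ω, c ω = ∑ ω ∈ Ω, (1 + (if (ω = ω₄ ∨ ω = ω₄') then 1 else 0)) := by
      rw [← Finset.sum_filter_add_sum_filter_not univ (fun ω => ω ∈ Ω)]
      have e0 : ∑ ω ∈ univ.filter (fun ω => ¬ ω ∈ Ω), c ω = 0 :=
        sum_eq_zero fun ω hω => by simp only [c, if_neg (mem_filter.1 hω).2]
      rw [e0, add_zero]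
      have ef : univ.filter (fun ω : Fin (6 + 6) → Bool => ω ∈ Ω) = Ω := by ext ω; simp
      rw [ef]
      refine sum_congr rfl fun ω hω => ?_
      simp only [c, if_pos hω]
      split_ifs <;> rfl
    have h2 : ∑ ω ∈ Ω, (if (ω = ω₄ ∨ ω = ω₄') then 1 else 0) ≤ 2 := by
      rw [sum_boole]
      calc #(Ω.filter fun ω => ω = ω₄ ∨ ω = ω₄') ≤ #({ω₄, ω₄'} : Finset (Fin (6 + 6) → Bool)) :=
            card_le_card fun ω hω => by
              rcases (mem_filter.1 hω).2 with h | h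
              · rw [h]; exact mem_insert_self _ _
              · rw [h]; exact mem_insert_of_mem (mem_singleton_self _)
        _ ≤ 2 := card_le_two
    rw [h1, sum_add_distrib, sum_const, smul_eq_mul, mul_one]
    omega
  have hind : ∀ q, (if q ∈ Ω then 1 else 0) ≤ c q := by
    intro q; simp only [c]; split_ifs <;> omega
  have hval : ∀ q, q ∈ Ω → c q ≤ 1 → e q = 2 ∨ e q = -2 := by
    intro q hq hc1
    rcases hΩsq q hq with h4 | heq
    · have h' : (e q - 2) * (e q + 2) = 0 := by ring_nf; linarith
      rcases mul_eq_zero.1 h' with h1 | h1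
      · left; linarith
      · right; linarith
    · exfalso
      simp only [c, if_pos hq, if_pos heq] at hc1
      omega
  -- the localisation: flat sum = inner sum + (seven translated sums ≡ R mod 8, |R| ≤ 2·hits, R even), hits ≤ weight
  have hloc : ∀ {k : ℕ} (_ : 2 ^ k * 63 < 1024) (x : Fin (6 + 6) → Bool), x ∈ Z → ∀ (a : Fin k → Fin (6 + 6) → Bool), (∀ i, a i ∈ V₀) →
      ∃ (t₁ t₂ t₃ : Fin (6 + 6) → Bool) (R : ℤ) (N : ℕ),
      (8 : ℤ) ∣ (∑ ε : Fin (k + 3) → Bool, e (fun j => x j ^^ decide (Odd #(univ.filter fun i =>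
          ε i && (Matrix.vecCons t₁ (Matrix.vecCons t₂ (Matrix.vecCons t₃ a)) : Fin (k + 3) → Fin (6 + 6) → Bool) i j)))) -
        (∑ ε : Fin k → Bool, e (fun j => x j ^^ decide (Odd #(univ.filter fun i => ε i && a i j)))) - R ∧
      |R| ≤ 2 * N ∧ Even R ∧ 512 * N ≤ 2 ^ k * 63 := by
    intro k hk x hx a ha
    obtain ⟨t₁, t₂, t₃, hoff, hcnt⟩ := tw18_dirs_few_hits_w V₀ Z c xZ y₁ y₂ y₃ h0 hadd hcardV hS hy₁ hy₂ hy₃ hy₁₂ hy₁₃ hy₂₃ hcΩ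
      x hx a ha
    set pt : (Fin k → Bool) → (Fin (6 + 6) → Bool) := fun ε => fun j => x j ^^ decide (Odd #(univ.filter fun i => ε i && a i j))
      with hpt
    set Wt := ∑ ε : Fin k → Bool,
        (c (bxor (pt ε) t₁) + c (bxor (pt ε) t₂) + c (bxor (bxor (pt ε) t₂) t₁) + c (bxor (pt ε) t₃) +
         c (bxor (bxor (pt ε) t₃) t₁) + c (bxor (bxor (pt ε) t₃) t₂) + c (bxor (bxor (bxor (pt ε) t₃) t₂) t₁)) with hWt
    have hW63 : 512 * Wt ≤ 2 ^ k * 63 := hcnt.trans (Nat.mul_le_mul_left _ hcsum)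
    have hW1 : Wt ≤ 1 := by
      by_contra h
      have : 1024 ≤ 512 * Wt := by omega
      omega
    have hWpt : ∀ ε, c (bxor (pt ε) t₁) + c (bxor (pt ε) t₂) + c (bxor (bxor (pt ε) t₂) t₁) + c (bxor (pt ε) t₃) +
        c (bxor (bxor (pt ε) t₃) t₁) + c (bxor (bxor (pt ε) t₃) t₂) + c (bxor (bxor (bxor (pt ε) t₃) t₂) t₁) ≤ Wt := fun ε =>
      single_le_sum (f := fun ε => c (bxor (pt ε) t₁) + c (bxor (pt ε) t₂) + c (bxor (bxor (pt ε) t₂) t₁) + c (bxor (pt ε) t₃) +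
        c (bxor (bxor (pt ε) t₃) t₁) + c (bxor (bxor (pt ε) t₃) t₂) + c (bxor (bxor (bxor (pt ε) t₃) t₂) t₁)) (fun _ _ => Nat.zero_le _)
        (mem_univ ε)
    obtain ⟨d1, b1, v1⟩ := tw18_family_mod8w e Z Ω hΩbad (fun ε => bxor (pt ε) t₁) (fun ε => (hoff ε).1)
      fun ε h => hval _ h (by have := hWpt ε; omega)
    obtain ⟨d2, b2, v2⟩ := tw18_family_mod8w e Z Ω hΩbad (fun ε => bxor (pt ε) t₂) (fun ε => (hoff ε).2.1)
      fun ε h => hval _ h (by have := hWpt ε; omega)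
    obtain ⟨d3, b3, v3⟩ := tw18_family_mod8w e Z Ω hΩbad (fun ε => bxor (bxor (pt ε) t₂) t₁) (fun ε => (hoff ε).2.2.1)
      fun ε h => hval _ h (by have := hWpt ε; omega)
    obtain ⟨d4, b4, v4⟩ := tw18_family_mod8w e Z Ω hΩbad (fun ε => bxor (pt ε) t₃) (fun ε => (hoff ε).2.2.2.1)
      fun ε h => hval _ h (by have := hWpt ε; omega)
    obtain ⟨d5, b5, v5⟩ := tw18_family_mod8w e Z Ω hΩbad (fun ε => bxor (bxor (pt ε) t₃) t₁) (fun ε => (hoff ε).2.2.2.2.1)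
      fun ε h => hval _ h (by have := hWpt ε; omega)
    obtain ⟨d6, b6, v6⟩ := tw18_family_mod8w e Z Ω hΩbad (fun ε => bxor (bxor (pt ε) t₃) t₂) (fun ε => (hoff ε).2.2.2.2.2.1)
      fun ε h => hval _ h (by have := hWpt ε; omega)
    obtain ⟨d7, b7, v7⟩ := tw18_family_mod8w e Z Ω hΩbad (fun ε => bxor (bxor (bxor (pt ε) t₃) t₂) t₁)
      (fun ε => (hoff ε).2.2.2.2.2.2) fun ε h => hval _ h (by have := hWpt ε; omega)
    set N := ∑ ε : Fin k → Bool,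
        ((if bxor (pt ε) t₁ ∈ Ω then 1 else 0) + (if bxor (pt ε) t₂ ∈ Ω then 1 else 0) +
         (if bxor (bxor (pt ε) t₂) t₁ ∈ Ω then 1 else 0) + (if bxor (pt ε) t₃ ∈ Ω then 1 else 0) +
         (if bxor (bxor (pt ε) t₃) t₁ ∈ Ω then 1 else 0) + (if bxor (bxor (pt ε) t₃) t₂ ∈ Ω then 1 else 0) +
         (if bxor (bxor (bxor (pt ε) t₃) t₂) t₁ ∈ Ω then 1 else 0)) with hN
    have hNW : N ≤ Wt := by
      refine sum_le_sum fun ε _ => ?_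
      have h₁ := hind (bxor (pt ε) t₁); have h₂ := hind (bxor (pt ε) t₂); have h₃ := hind (bxor (bxor (pt ε) t₂) t₁)
      have h₄ := hind (bxor (pt ε) t₃); have h₅ := hind (bxor (bxor (pt ε) t₃) t₁); have h₆ := hind (bxor (bxor (pt ε) t₃) t₂)
      have h₇ := hind (bxor (bxor (bxor (pt ε) t₃) t₂) t₁)
      omega
    refine ⟨t₁, t₂, t₃,
      (∑ ε : Fin k → Bool, (if bxor (pt ε) t₁ ∈ Ω then e (bxor (pt ε) t₁) else 0)) +
      (∑ ε : Fin k → Bool, (if bxor (pt ε) t₂ ∈ Ω then e (bxor (pt ε) t₂) else 0)) +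
      (∑ ε : Fin k → Bool, (if bxor (bxor (pt ε) t₂) t₁ ∈ Ω then e (bxor (bxor (pt ε) t₂) t₁) else 0)) +
      (∑ ε : Fin k → Bool, (if bxor (pt ε) t₃ ∈ Ω then e (bxor (pt ε) t₃) else 0)) +
      (∑ ε : Fin k → Bool, (if bxor (bxor (pt ε) t₃) t₁ ∈ Ω then e (bxor (bxor (pt ε) t₃) t₁) else 0)) +
      (∑ ε : Fin k → Bool, (if bxor (bxor (pt ε) t₃) t₂ ∈ Ω then e (bxor (bxor (pt ε) t₃) t₂) else 0)) +
      (∑ ε : Fin k → Bool, (if bxor (bxor (bxor (pt ε) t₃) t₂) t₁ ∈ Ω then e (bxor (bxor (bxor (pt ε) t₃) t₂) t₁) else 0)),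
      N, ?_, ?_, ?_, (Nat.mul_le_mul_left _ hNW).trans hW63⟩
    · rw [tw18_peel3 e x t₁ t₂ t₃ a]
      simp only [sum_add_distrib]
      have := dvd_add (dvd_add (dvd_add (dvd_add (dvd_add (dvd_add d1 d2) d3) d4) d5) d6) d7
      have e7 : ∀ (A B C D E F G a b c d e' f' g' P : ℤ),
          P + (A + B + C + D + E + F + G) - P - (a + b + c + d + e' + f' + g') =
            (A - a) + (B - b) + (C - c) + (D - d) + (E - e') + (F - f') + (G - g') := fun _ _ _ _ _ _ _ _ _ _ _ _ _ _ _ => by ring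
      rw [e7]
      exact this
    · simp only [N]
      push_cast
      simp only [sum_add_distrib]
      have h7abs : ∀ A B C D E F G : ℤ, |A + B + C + D + E + F + G| ≤ |A| + |B| + |C| + |D| + |E| + |F| + |G| := by
        intro A B C D E F G
        linarith [abs_add_le (A + B + C + D + E + F) G, abs_add_le (A + B + C + D + E) F, abs_add_le (A + B + C + D) E,
          abs_add_le (A + B + C) D, abs_add_le (A + B) C, abs_add_le A B]
      refine (h7abs _ _ _ _ _ _ _).trans ?_
      linarith [b1, b2, b3, b4, b5, b6, b7]
    · exact ((((((v1.add v2).add v3).add v4).add v5).add v6).add v7)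
  -- (H3): no hit at all for an inner 3-flat
  have H3 : ∀ x ∈ Z, ∀ a b c : Fin (6 + 6) → Bool, a ∈ V₀ → b ∈ V₀ → c ∈ V₀ →
      (4 : ℤ) ∣ ∑ ε : Fin 3 → Bool, e (fun j => x j ^^ decide (Odd #(univ.filter fun i =>
        ε i && (![a, b, c] : Fin 3 → Fin (6 + 6) → Bool) i j))) := by
    intro x hx a b c' ha hb hc
    obtain ⟨t₁, t₂, t₃, R, N, hdvd, hR, -, hN⟩ := hloc (by norm_num) x hx ![a, b, c'] (fun i => by fin_cases i <;> assumption)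
    have hN0 : N = 0 := by norm_num at hN; omega
    have hR0 : R = 0 := by rw [hN0] at hR; simpa using hR
    have h4 : (4 : ℤ) ∣ ∑ ε : Fin (3 + 3) → Bool, e (fun j => x j ^^ decide (Odd #(univ.filter fun i =>
        ε i && (Matrix.vecCons t₁ (Matrix.vecCons t₂ (Matrix.vecCons t₃ ![a, b, c'])) : Fin (3 + 3) → Fin (6 + 6) → Bool) i j))) :=
      tw15_e_flat6 f g hf hg u'' hu'' x _
    rw [hR0, sub_zero] at hdvd
    have h4' := (show (4 : ℤ) ∣ 8 by norm_num).trans hdvd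
    have := dvd_sub h4 h4'
    simpa using this
  refine ⟨H3, ?_⟩
  -- (H4): at most one hit for an inner 4-flat; the remainder `R` is `0` by (H3) on the two inner 3-flats
  intro x hx a₀ a₁ a₂ a₃ ha₀ ha₁ ha₂ ha₃
  obtain ⟨t₁, t₂, t₃, R, N, hdvd, hR, hReven, hN⟩ := hloc (by norm_num) x hx ![a₀, a₁, a₂, a₃]
    (fun i => by fin_cases i <;> assumption)
  have hN1 : N ≤ 1 := by norm_num at hN; omega
  have h8 : (8 : ℤ) ∣ ∑ ε : Fin (4 + 3) → Bool, e (fun j => x j ^^ decide (Odd #(univ.filter fun i =>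
      ε i && (Matrix.vecCons t₁ (Matrix.vecCons t₂ (Matrix.vecCons t₃ ![a₀, a₁, a₂, a₃])) : Fin (4 + 3) → Fin (6 + 6) → Bool) i j))) :=
    tw15_e_flat7 f g hf hg u'' hu'' x _
  have h4 : (4 : ℤ) ∣ ∑ ε : Fin 4 → Bool, e (fun j => x j ^^ decide (Odd #(univ.filter fun i =>
      ε i && (![a₀, a₁, a₂, a₃] : Fin 4 → Fin (6 + 6) → Bool) i j))) := by
    have hp := fr_sum_peel e x a₀ ![a₁, a₂, a₃]
    rw [hp]
    refine dvd_add (H3 x hx a₁ a₂ a₃ ha₁ ha₂ ha₃) ?_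
    have hx' : bxor x a₀ ∈ Z := hPV x hx a₀ ha₀
    have h3' := H3 (bxor x a₀) hx' a₁ a₂ a₃ ha₁ ha₂ ha₃
    have e1 : ∀ ε : Fin 3 → Bool, bxor (fun j => x j ^^ decide (Odd #(univ.filter fun i =>
        ε i && (![a₁, a₂, a₃] : Fin 3 → Fin (6 + 6) → Bool) i j))) a₀ =
        fun j => (bxor x a₀) j ^^ decide (Odd #(univ.filter fun i => ε i && (![a₁, a₂, a₃] : Fin 3 → Fin (6 + 6) → Bool) i j)) := by
      intro ε
      funext j
      simp only [bxor]
      cases x j <;> cases a₀ j <;> simp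
    rw [sum_congr rfl fun ε _ => by rw [e1 ε]]
    exact h3'
  have hR2 : |R| ≤ 2 := by
    have : (N : ℤ) ≤ 1 := by exact_mod_cast hN1
    linarith
  obtain ⟨c', hc'⟩ := hReven
  obtain ⟨q, hq⟩ := h4
  rw [hq] at hdvd ⊢
  obtain ⟨m, hm⟩ := h8
  rw [hm] at hdvd
  obtain ⟨r, hr⟩ := hdvd
  rw [abs_le] at hR2
  have : (2 : ℤ) ∣ q := by omega
  obtain ⟨q', rfl⟩ := this
  exact ⟨q', by ring⟩

end Summit.QuantumAdvantage.QuantumAdvantage.Theorems.CubicForrelation.NearExactIsExact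

end
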